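import Summits.MatrixMultiplication.OmegaCensus.STPPVosperSlackFourCell22RowsAsmG1
import Summits.MatrixMultiplication.OmegaCensus.STPPVosperSlackFourCell22RowsAsmG2
import Summits.MatrixMultiplication.OmegaCensus.STPPVosperSlackFourCell22RowsAsmG3
import Summits.MatrixMultiplication.OmegaCensus.STPPVosperSlackFourCell22RowsAsmG4
import Summits.MatrixMultiplication.OmegaCensus.STPPVosperSlackFourCell22RowsAsmG5
import Summits.MatrixMultiplication.OmegaCensus.STPPVosperSlackFourCell22RowsAsmG6

/-!
# ω-census (abelian STPP census): cell (2,2) checker rows — ALL units assembled (no new computation)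

HONEST FRAMING (pub-omega census; verbatim): lottery ticket; floor = certified bounds/negative ranges.
Census STRUCTURE (seat pub-omega-stpp-2 gen 28, 2026-08-29), family (b2).  `c22_rows61` : for every `u ∈ [1, 60]`, `y₀, y₀′ ∈ {2,3,4}` and every shape
`S ∈ c22Sh y₀`, the cell-(2,2) check passes on the dead table `tbl22` — the computational hypothesis of the cell-(2,2) soundness theorem
(`STPPVosperSlackFourCell22Sound.lean`).  Nothing here is progress on `ω`.
-/

namespace Summit.MatrixMultiplication.OmegaCensus.CubeNB.S2

/-- **ALL CELL-(2,2) ROWS at p = 61.** [folklore] -/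
theorem c22_rows61 : ∀ u ∈ List.range' 1 60, ∀ y₀ ∈ [2, 3, 4], ∀ y₀' ∈ [2, 3, 4], ∀ S ∈ c22Sh y₀,
    c22CheckS 61 u (c22P 61 y₀) (c22Q 61 u y₀') S (c22TShapes 61 u (c22Sh y₀')) tbl22 = true := by
  intro u hu
  rw [List.mem_range'_1] at hu
  obtain ⟨h1, h2⟩ := hu
  interval_cases u
  · exact c22u_1
  · exact c22u_2
  · exact c22u_3
  · exact c22u_4
  · exact c22u_5
  · exact c22u_6
  · exact c22u_7
  · exact c22u_8
  · exact c22u_9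
  · exact c22u_10
  · exact c22u_11
  · exact c22u_12
  · exact c22u_13
  · exact c22u_14
  · exact c22u_15
  · exact c22u_16
  · exact c22u_17
  · exact c22u_18
  · exact c22u_19
  · exact c22u_20
  · exact c22u_21
  · exact c22u_22
  · exact c22u_23
  · exact c22u_24
  · exact c22u_25
  · exact c22u_26
  · exact c22u_27
  · exact c22u_28
  · exact c22u_29
  · exact c22u_30
  · exact c22u_31
  · exact c22u_32
  · exact c22u_33
  · exact c22u_34
  · exact c22u_35
  · exact c22u_36
  · exact c22u_37
  · exact c22u_38
  · exact c22u_39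
  · exact c22u_40
  · exact c22u_41
  · exact c22u_42
  · exact c22u_43
  · exact c22u_44
  · exact c22u_45
  · exact c22u_46
  · exact c22u_47
  · exact c22u_48
  · exact c22u_49
  · exact c22u_50
  · exact c22u_51
  · exact c22u_52
  · exact c22u_53
  · exact c22u_54
  · exact c22u_55
  · exact c22u_56
  · exact c22u_57
  · exact c22u_58
  · exact c22u_59
  · exact c22u_60

end Summit.MatrixMultiplication.OmegaCensus.CubeNB.S2
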